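import Mathlib
import HarnessLib

/-!
# Rectangular cells of a triangular layer (step S4(i) of stub (B), line `LayerChain` v4, crux
# `StackingLiminf`, stmt-Ventures-19145)

Route `StickyWulffConstant` of the venture `Summits/Ventures/Crystal3D` (cell `crystal3d-full`).
A layer of `barlowStacking 1 √(2/3) σ` projects laterally onto the sheared triangular lattice
`P(i,j) = (i + j/2 + c₁, (√3/2) j + c₂)` (`c = (L_k/2, √3 L_k/6)` for layer `k`).  The half-open
RECTANGLES `Q(p) = [p₁, p₁+1) × [p₂, p₂ + √3/2)` are a fundamental domain of that lattice:
`exists_layerCells` gives measurability, area exactly `√3/2` (= 1/areal density), the coordinate bounds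
`0 ≤ q − p < (1, √3/2)`, DISJOINTNESS over distinct lattice points of one layer, and COVERING of `ℝ²`
(`j = ⌊(q₂ − c₂)/(√3/2)⌋`, `i = ⌊q₁ − j/2 − c₁⌋`).  This is the 2-D packing device behind the
rate-`1/K²` per-layer quadrature of the mollifier (`…LayerSum`), itself the input of the skew bound
`|E_full| ≤ C/K` of BLUEPRINT-v4B S4(i).
WHAT THIS IS NOT: not stub (B); rung F-C1 not moved.
-/

noncomputable section

namespace Summit.Ventures.Crystal3D.Theorems.PlateauHeight

open MeasureTheory Set

/-- **Layer cells.**  For the sheared triangular lattice `P(i,j) = (i + j/2 + c₁, (√3/2)·j + c₂)`: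
rectangles `Q p = [p₁, p₁ + 1) × [p₂, p₂ + √3/2)` are measurable, of area `√3/2`, contain only points
with `0 ≤ q₁ − p₁ < 1`, `0 ≤ q₂ − p₂ < √3/2`, are pairwise disjoint over the lattice, and cover `ℝ²`. -/
theorem exists_layerCells (c₁ c₂ : ℝ) :
    ∃ Q : ℝ × ℝ → Set (ℝ × ℝ),
      (∀ p, MeasurableSet (Q p)) ∧
      (∀ p, volume (Q p) = ENNReal.ofReal (Real.sqrt 3 / 2)) ∧
      (∀ p, ∀ q ∈ Q p, 0 ≤ q.1 - p.1 ∧ q.1 - p.1 < 1 ∧ 0 ≤ q.2 - p.2 ∧ q.2 - p.2 < Real.sqrt 3 / 2) ∧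
      (∀ i j i' j' : ℤ, (i, j) ≠ (i', j') →
        Disjoint (Q ((i : ℝ) + j / 2 + c₁, Real.sqrt 3 / 2 * j + c₂))
          (Q ((i' : ℝ) + j' / 2 + c₁, Real.sqrt 3 / 2 * j' + c₂))) ∧
      (∀ q : ℝ × ℝ, ∃ i j : ℤ, q ∈ Q ((i : ℝ) + j / 2 + c₁, Real.sqrt 3 / 2 * j + c₂)) := by
  have h3 : 0 < Real.sqrt 3 := Real.sqrt_pos.2 (by norm_num)
  set s : ℝ := Real.sqrt 3 / 2 with hs
  have hs0 : 0 < s := by positivity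
  refine ⟨fun p => Ico p.1 (p.1 + 1) ×ˢ Ico p.2 (p.2 + s), fun p => ?_, fun p => ?_, fun p q hq => ?_,
    fun i j i' j' hne => ?_, fun q => ?_⟩
  · exact measurableSet_Ico.prod measurableSet_Ico
  · rw [Measure.volume_eq_prod, Measure.prod_prod, Real.volume_Ico, Real.volume_Ico,
      ← ENNReal.ofReal_mul (by linarith)]
    congr 1; ring
  · rw [Set.mem_prod, mem_Ico, mem_Ico] at hq
    refine ⟨by linarith [hq.1.1], by linarith [hq.1.2], by linarith [hq.2.1], by linarith [hq.2.2]⟩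
  · rw [Set.disjoint_left]
    intro q hq hq'
    apply hne
    rw [Set.mem_prod, mem_Ico, mem_Ico] at hq hq'
    simp only at hq hq'
    -- second coordinates: `|s (j − j')| < s` ⇒ `j = j'`
    have hj : j = j' := by
      have h1 : s * ((j : ℝ) - j') < s := by nlinarith [hq.2.1, hq.2.2, hq'.2.1, hq'.2.2]
      have h2 : -s < s * ((j : ℝ) - j') := by nlinarith [hq.2.1, hq.2.2, hq'.2.1, hq'.2.2]
      have h3' : ((j : ℝ) - j') < 1 := by
        by_contra hc; rw [not_lt] at hc; nlinarith
      have h4 : (-1 : ℝ) < (j : ℝ) - j' := by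
        by_contra hc; rw [not_lt] at hc; nlinarith
      have e1 : ((j - j' : ℤ) : ℝ) < 1 := by push_cast; exact h3'
      have e2 : (-1 : ℝ) < ((j - j' : ℤ) : ℝ) := by push_cast; exact h4
      have : j - j' < 1 := by exact_mod_cast e1
      have : -1 < j - j' := by exact_mod_cast e2
      omega
    subst hj
    have hi : i = i' := by
      have h3' : ((i : ℝ) - i') < 1 := by linarith [hq.1.1, hq.1.2, hq'.1.1, hq'.1.2]
      have h4 : (-1 : ℝ) < (i : ℝ) - i' := by linarith [hq.1.1, hq.1.2, hq'.1.1, hq'.1.2]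
      have e1 : ((i - i' : ℤ) : ℝ) < 1 := by push_cast; exact h3'
      have e2 : (-1 : ℝ) < ((i - i' : ℤ) : ℝ) := by push_cast; exact h4
      have : i - i' < 1 := by exact_mod_cast e1
      have : -1 < i - i' := by exact_mod_cast e2
      omega
    rw [hi]
  · -- covering
    set j : ℤ := ⌊(q.2 - c₂) / s⌋ with hj
    set i : ℤ := ⌊q.1 - j / 2 - c₁⌋ with hi
    refine ⟨i, j, ?_⟩
    rw [Set.mem_prod, mem_Ico, mem_Ico]
    have hj1 : (j : ℝ) ≤ (q.2 - c₂) / s := Int.floor_le _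
    have hj2 : (q.2 - c₂) / s < j + 1 := Int.lt_floor_add_one _
    have hi1 : (i : ℝ) ≤ q.1 - j / 2 - c₁ := Int.floor_le _
    have hi2 : q.1 - j / 2 - c₁ < i + 1 := Int.lt_floor_add_one _
    rw [le_div_iff₀ hs0] at hj1
    rw [div_lt_iff₀ hs0] at hj2
    simp only
    refine ⟨⟨by linarith, by linarith⟩, ⟨by linarith, by linarith⟩⟩

end Summit.Ventures.Crystal3D.Theorems.PlateauHeight

end
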